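import Mathlib.Analysis.Matrix.Normed
import Mathlib.Analysis.Calculus.Deriv.Add
import Mathlib.Analysis.Calculus.Deriv.Mul
import Mathlib.Analysis.Calculus.Deriv.Comp
import Mathlib.Analysis.Calculus.FDeriv.Mul
import Mathlib.Analysis.Normed.Ring.Units
import Mathlib.LinearAlgebra.Matrix.NonsingularInverse
import Mathlib.Topology.Instances.Matrix
import Summits.QuantumFields.BalabanUV.Beta.FP.MatrixInvDeriv
import Summits.QuantumFields.BalabanUV.Beta.GAN24.InverseRate

/-!
# `BalabanUV.Beta.FP.InverseSymbolDeriv` — road «FP» for binder row D1, leaf H2-P of the horizontal route H′ (owner rulings R-FP-15 ∕ R-FP-17,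
# `HOME/b2b-balaban-beta-d1-p3/LEAVES-FP.md` row **H2-P-INV**): ABSTRACT MATRIX CALCULUS ALONG ONE REAL PARAMETER — the inverse of a `C³` matrix curve
# is `C³` with an EXPLICIT derivative chain, and on a punctured neighbourhood the chain has DEGREES `−2, −3, −4, −5` when the curve has degrees `2, 1, 0, 0`

HONEST DEPENDENCY (page 1, mandatory): continuum YM on T⁴ ⇐ BetaPertH ∧ nine spine estimates (0/9 proved); BetaPertH ⇐ (D1) ∧ (D4) ∧ CAP+tail;
G-an2-4 gates asym, D1 and NE2/3/4.  HONEST FRAMING (cell contract, verbatim): «discharging `BetaPertH` makes Bałaban's UV stability UNCONDITIONAL —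
a real constructive-QFT result; it is NOT the continuum limit and NOT the Clay problem.»  THIS MODULE DISCHARGES NOTHING of the wall: [folklore] calculus of
matrix curves (Mathlib `HasDerivAt`; the first-derivative formula `hasDerivAt_matrix_inv` and the entry projection `hasDerivAt_entry` are gan24-leaf-05-g34's `FP/MatrixInvDeriv`, imported BY NAME) and arithmetic of powers, GENERIC — no `PinfSym`, no `feynMat`,
no `W_∞`, no Bałaban object inside.  Three [our object] data defs (`invD1`, `invD2`, `invD3` — the named members of the chain); no `def … : Prop`; nothing cited as a
hypothesis; 0 sorry; 0 wall binders; NOT (CONV-C), NOT D1, NOT BetaPertH, NOT continuum, NOT Clay.  «not in print; our bookkeeping».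

ABSOLUTE RULE (cell charter, verbatim): «No internally-minted statement may enter as a cited fact. Every hypothesis is either kernel-proved in this package or a
verbatim quotation of a PUBLISHED theorem with page reference. The manuscript(s) under audit are NOT citable for their own disputed steps — they are the thing
under adjudication; programme-internal (2001/route/tribunal) claims are never citable.»

SETTING.  `A₀ A₁ A₂ A₃ : ℝ → Matrix n n ℂ` and ONE parameter value `t` with the POINTWISE chain `HasDerivAt A₀ (A₁ t) t`, `HasDerivAt A₁ (A₂ t) t`,
`HasDerivAt A₂ (A₃ t) t` and `IsUnit (A₀ t).det` (no open set is needed anywhere: every statement is at one `t`, so the module plugs slice by slice into the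
`hder` ∕ `hcont` data of the cell's integration-by-parts engines `Beta.AliasingTailDeriv.fourierBox_coordDeriv` ∕ `FP/PuncturedCoordDeriv`).  Norm = Mathlib's
`L∞`-operator norm on matrices (`open scoped Matrix.Norms.Operator`; submultiplicative), the currency of `GAN24/InverseRate` (whose bridges `norm_entry_le` ∕ `norm_le_card_mul` ∕ `norm_mul3_le` are used BY NAME).

WHAT.
* §1 THE CHAIN: `hasDerivAt_mul₃` (Leibniz for a triple product); [our object] `invD1 A₀ A₁ t := −A₀(t)⁻¹·A₁(t)·A₀(t)⁻¹`, `invD2` (three terms), `invD3` (nine terms);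
  **`hasDerivAt_inv`**: `HasDerivAt (s ↦ A₀(s)⁻¹) (invD1 A₀ A₁ t) t`, **`hasDerivAt_invD1`**: `HasDerivAt (invD1 A₀ A₁) (invD2 A₀ A₁ A₂ t) t`,
  **`hasDerivAt_invD2`**: `HasDerivAt (invD2 A₀ A₁ A₂) (invD3 A₀ A₁ A₂ A₃ t) t` — `t ↦ A(t)⁻¹` is `C³` along the line, in chain form.
* §2 LETTER BOUNDS: from `‖A₀(t)⁻¹‖ ≤ p`, `‖A₁ t‖ ≤ a₁`, `‖A₂ t‖ ≤ a₂`, `‖A₃ t‖ ≤ a₃`: **`norm_invD1_le`** `≤ p·a₁·p`, **`norm_invD2_le`** `≤ 2p³a₁² + p²a₂`,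
  **`norm_invD3_le`** `≤ 6p⁴a₁³ + 6p³a₁a₂ + p²a₃`.
* §3 POWER COUNTING (the row's literal «`‖(A⁻¹)^{(j)}‖ ≤ C_j·r^{−2−j}`, `j ≤ 3`»): with `p = c₀∕r²`, `a₁ = c₁·r`, `a₂ = c₂`, `a₃ = c₃`, `0 < r`:
  **`norm_invD1_le_div_cube`** `≤ c₀²c₁∕r³`, **`norm_invD2_le_div_pow_four`** `≤ (2c₀³c₁² + c₀²c₂)∕r⁴`, and for `r ≤ R` **`norm_invD3_le_div_pow_five`**
  `≤ (6c₀⁴c₁³ + 6c₀³c₁c₂ + c₀²c₃R)∕r⁵` (the `A₃` term `c₀²c₃∕r⁴ ≤ c₀²c₃R∕r⁵` is where the bounded zone enters) — entrywise exits in §4.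
* §4 ENTRYWISE EXITS in the currency of `FP/PerfectPropagatorBound` (`‖PinfSym s ph α β‖ ≤ …`); the bridges `‖M i j‖ ≤ ‖M‖` ∕ `‖M‖ ≤ (card of columns)·c` are
  `GAN24/InverseRate.norm_entry_le` ∕ `norm_le_card_mul` BY NAME (same norm scope), so entrywise hypotheses ENTER with one factor `card n` per letter.
* §6 ENTRY-LEVEL CHAIN: `hasDerivAt_inv_apply`, `hasDerivAt_invD1_apply`, `hasDerivAt_invD2_apply` (via `MatrixInvDeriv.hasDerivAt_entry` BY NAME).
* §5 CONTINUITY (the `hcont` data): `continuousWithinAt_inv`, `continuousOn_inv`, `continuousOn_invD1`, `continuousOn_invD2`, `continuousOn_invD3` on any set where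
  `A₀, …, A₃` are continuous and `det A₀` is pointwise a unit (Mathlib `continuousAt_matrix_inv` + `NormedRing.inverse_continuousAt`).
USE (row H2-P-B, not here): `A₀ := t ↦ feynMat (Re W_∞(·,·; i.insertNth t q)) (d1Sym (i.insertNth t q))` (`q ≠ 0`), `c₀` from H2-P-BND `PerfectPropagatorBound.norm_PinfSym_le`
(via §4), `c₁, c₂, c₃` from H2-P-REG; the free part `−|p̂|⁻²·𝟙` and the `(e^{is_j} − 1)` factors are H2-P-B's Leibniz bookkeeping.
Provenance: G-an2-4 swarm leaf prover 01, gen 46 (prover-b2b-balaban-gan24-formalise-leaf-01-g46-0), cross-lane on road FP (journal CLAIM l.20066), 2026-08-20.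
-/

noncomputable section

namespace Summit.QuantumFields.BalabanUV.Beta.FP.InverseSymbolDeriv

open scoped Matrix.Norms.Operator
open Matrix
open Summit.QuantumFields.BalabanUV.Beta.FP.MatrixInvDeriv (hasDerivAt_matrix_inv hasDerivAt_entry)
open Summit.QuantumFields.BalabanUV.Beta.GAN24.InverseRate (norm_entry_le norm_mul3_le)

variable {n : Type*} [Fintype n] [DecidableEq n]

/-! ## §1 The explicit derivative chain of the inverse -/

/-- [folklore] Leibniz rule for a triple product of matrix curves along a real parameter. -/
theorem hasDerivAt_mul₃ {X Y Z : ℝ → Matrix n n ℂ} {X' Y' Z' : Matrix n n ℂ} {t : ℝ}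
    (hX : HasDerivAt X X' t) (hY : HasDerivAt Y Y' t) (hZ : HasDerivAt Z Z' t) :
    HasDerivAt (fun s => X s * Y s * Z s) (X' * Y t * Z t + X t * Y' * Z t + X t * Y t * Z') t := by
  have h := (hX.fun_mul hY).fun_mul hZ
  refine h.congr_deriv ?_
  noncomm_ring

/-- [our object] The FIRST derivative of the inverse along the chain `(A₀, A₁)`: `invD1 A₀ A₁ t := −A₀(t)⁻¹·A₁(t)·A₀(t)⁻¹`. -/
def invD1 (A₀ A₁ : ℝ → Matrix n n ℂ) (t : ℝ) : Matrix n n ℂ := -((A₀ t)⁻¹ * A₁ t * (A₀ t)⁻¹)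

/-- [our object] The SECOND derivative of the inverse along the chain `(A₀, A₁, A₂)` (Leibniz expansion of `invD1`, three terms). -/
def invD2 (A₀ A₁ A₂ : ℝ → Matrix n n ℂ) (t : ℝ) : Matrix n n ℂ :=
  -(invD1 A₀ A₁ t * A₁ t * (A₀ t)⁻¹ + (A₀ t)⁻¹ * A₂ t * (A₀ t)⁻¹ + (A₀ t)⁻¹ * A₁ t * invD1 A₀ A₁ t)

/-- [our object] The THIRD derivative of the inverse along the chain `(A₀, A₁, A₂, A₃)` (raw Leibniz expansion of `invD2`, nine terms). -/
def invD3 (A₀ A₁ A₂ A₃ : ℝ → Matrix n n ℂ) (t : ℝ) : Matrix n n ℂ :=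
  -((invD2 A₀ A₁ A₂ t * A₁ t * (A₀ t)⁻¹ + invD1 A₀ A₁ t * A₂ t * (A₀ t)⁻¹ + invD1 A₀ A₁ t * A₁ t * invD1 A₀ A₁ t)
    + (invD1 A₀ A₁ t * A₂ t * (A₀ t)⁻¹ + (A₀ t)⁻¹ * A₃ t * (A₀ t)⁻¹ + (A₀ t)⁻¹ * A₂ t * invD1 A₀ A₁ t)
    + (invD1 A₀ A₁ t * A₁ t * invD1 A₀ A₁ t + (A₀ t)⁻¹ * A₂ t * invD1 A₀ A₁ t + (A₀ t)⁻¹ * A₁ t * invD2 A₀ A₁ A₂ t))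

section Chain

variable {A₀ A₁ A₂ A₃ : ℝ → Matrix n n ℂ} {t : ℝ}

/-- [folklore] `d/dt A₀(t)⁻¹ = invD1 A₀ A₁ t` at a point where `A₀` has derivative `A₁ t` and `det A₀(t)` is a unit. -/
theorem hasDerivAt_inv (h₀ : HasDerivAt A₀ (A₁ t) t) (hdet : IsUnit (A₀ t).det) :
    HasDerivAt (fun s => (A₀ s)⁻¹) (invD1 A₀ A₁ t) t :=
  hasDerivAt_matrix_inv h₀ hdet

/-- [our object] `d/dt invD1 = invD2` (pointwise: needs the chain `A₀ → A₁ → A₂` at `t` and `det A₀(t)` a unit). -/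
theorem hasDerivAt_invD1 (h₀ : HasDerivAt A₀ (A₁ t) t) (h₁ : HasDerivAt A₁ (A₂ t) t) (hdet : IsUnit (A₀ t).det) :
    HasDerivAt (invD1 A₀ A₁) (invD2 A₀ A₁ A₂ t) t := by
  have hP := hasDerivAt_inv h₀ hdet
  have h := (hasDerivAt_mul₃ hP h₁ hP).fun_neg
  exact h

/-- [our object] `d/dt invD2 = invD3` (pointwise: needs the chain `A₀ → A₁ → A₂ → A₃` at `t` and `det A₀(t)` a unit). -/
theorem hasDerivAt_invD2 (h₀ : HasDerivAt A₀ (A₁ t) t) (h₁ : HasDerivAt A₁ (A₂ t) t) (h₂ : HasDerivAt A₂ (A₃ t) t)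
    (hdet : IsUnit (A₀ t).det) :
    HasDerivAt (invD2 A₀ A₁ A₂) (invD3 A₀ A₁ A₂ A₃ t) t := by
  have hP := hasDerivAt_inv h₀ hdet
  have hD1 := hasDerivAt_invD1 h₀ h₁ hdet
  have hT1 := hasDerivAt_mul₃ hD1 h₁ hP
  have hT2 := hasDerivAt_mul₃ hP h₂ hP
  have hT3 := hasDerivAt_mul₃ hP h₁ hD1
  exact ((hT1.add hT2).add hT3).fun_neg

end Chain

/-! ## §2 Letter bounds (submultiplicativity of the `L∞`-operator norm; `GAN24/InverseRate.norm_mul3_le` BY NAME) -/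

section Letters

variable {A₀ A₁ A₂ A₃ : ℝ → Matrix n n ℂ} {t : ℝ} {p a₁ a₂ a₃ : ℝ}

/-- [our object] `‖invD1‖ ≤ p·a₁·p` from `‖A₀⁻¹‖ ≤ p`, `‖A₁‖ ≤ a₁`. -/
theorem norm_invD1_le (hp : ‖(A₀ t)⁻¹‖ ≤ p) (h₁ : ‖A₁ t‖ ≤ a₁) : ‖invD1 A₀ A₁ t‖ ≤ p * a₁ * p := by
  have hp0 : 0 ≤ p := (norm_nonneg _).trans hp
  have ha0 : 0 ≤ a₁ := (norm_nonneg _).trans h₁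
  unfold invD1
  rw [norm_neg]
  calc ‖(A₀ t)⁻¹ * A₁ t * (A₀ t)⁻¹‖ ≤ ‖(A₀ t)⁻¹‖ * ‖A₁ t‖ * ‖(A₀ t)⁻¹‖ := norm_mul3_le _ _ _
    _ ≤ p * a₁ * p := by gcongr

/-- [our object] `‖invD2‖ ≤ 2p³a₁² + p²a₂` from `‖A₀⁻¹‖ ≤ p`, `‖A₁‖ ≤ a₁`, `‖A₂‖ ≤ a₂`. -/
theorem norm_invD2_le (hp : ‖(A₀ t)⁻¹‖ ≤ p) (h₁ : ‖A₁ t‖ ≤ a₁) (h₂ : ‖A₂ t‖ ≤ a₂) :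
    ‖invD2 A₀ A₁ A₂ t‖ ≤ 2 * p ^ 3 * a₁ ^ 2 + p ^ 2 * a₂ := by
  have hp0 : 0 ≤ p := (norm_nonneg _).trans hp
  have ha0 : 0 ≤ a₁ := (norm_nonneg _).trans h₁
  have hb0 : 0 ≤ a₂ := (norm_nonneg _).trans h₂
  have hD1 := norm_invD1_le hp h₁
  unfold invD2
  rw [norm_neg]
  calc ‖invD1 A₀ A₁ t * A₁ t * (A₀ t)⁻¹ + (A₀ t)⁻¹ * A₂ t * (A₀ t)⁻¹ + (A₀ t)⁻¹ * A₁ t * invD1 A₀ A₁ t‖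
      ≤ ‖invD1 A₀ A₁ t * A₁ t * (A₀ t)⁻¹‖ + ‖(A₀ t)⁻¹ * A₂ t * (A₀ t)⁻¹‖ + ‖(A₀ t)⁻¹ * A₁ t * invD1 A₀ A₁ t‖ :=
        norm_add₃_le
    _ ≤ ‖invD1 A₀ A₁ t‖ * ‖A₁ t‖ * ‖(A₀ t)⁻¹‖ + ‖(A₀ t)⁻¹‖ * ‖A₂ t‖ * ‖(A₀ t)⁻¹‖
        + ‖(A₀ t)⁻¹‖ * ‖A₁ t‖ * ‖invD1 A₀ A₁ t‖ := by
        gcongr <;> exact norm_mul3_le _ _ _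
    _ ≤ (p * a₁ * p) * a₁ * p + p * a₂ * p + p * a₁ * (p * a₁ * p) := by gcongr
    _ = 2 * p ^ 3 * a₁ ^ 2 + p ^ 2 * a₂ := by ring

/-- [our object] `‖invD3‖ ≤ 6p⁴a₁³ + 6p³a₁a₂ + p²a₃` from `‖A₀⁻¹‖ ≤ p`, `‖A₁‖ ≤ a₁`, `‖A₂‖ ≤ a₂`, `‖A₃‖ ≤ a₃`. -/
theorem norm_invD3_le (hp : ‖(A₀ t)⁻¹‖ ≤ p) (h₁ : ‖A₁ t‖ ≤ a₁) (h₂ : ‖A₂ t‖ ≤ a₂) (h₃ : ‖A₃ t‖ ≤ a₃) :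
    ‖invD3 A₀ A₁ A₂ A₃ t‖ ≤ 6 * p ^ 4 * a₁ ^ 3 + 6 * p ^ 3 * a₁ * a₂ + p ^ 2 * a₃ := by
  have hp0 : 0 ≤ p := (norm_nonneg _).trans hp
  have ha0 : 0 ≤ a₁ := (norm_nonneg _).trans h₁
  have hb0 : 0 ≤ a₂ := (norm_nonneg _).trans h₂
  have hc0 : 0 ≤ a₃ := (norm_nonneg _).trans h₃
  have hD1 := norm_invD1_le hp h₁
  have hD2 := norm_invD2_le hp h₁ h₂
  set P := (A₀ t)⁻¹ with hPdef
  set D1 := invD1 A₀ A₁ t with hD1def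
  set D2 := invD2 A₀ A₁ A₂ t with hD2def
  unfold invD3
  rw [norm_neg, ← hPdef, ← hD1def, ← hD2def]
  calc ‖D2 * A₁ t * P + D1 * A₂ t * P + D1 * A₁ t * D1 + (D1 * A₂ t * P + P * A₃ t * P + P * A₂ t * D1)
        + (D1 * A₁ t * D1 + P * A₂ t * D1 + P * A₁ t * D2)‖
      ≤ ‖D2 * A₁ t * P + D1 * A₂ t * P + D1 * A₁ t * D1‖ + ‖D1 * A₂ t * P + P * A₃ t * P + P * A₂ t * D1‖
        + ‖D1 * A₁ t * D1 + P * A₂ t * D1 + P * A₁ t * D2‖ := norm_add₃_le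
    _ ≤ (‖D2 * A₁ t * P‖ + ‖D1 * A₂ t * P‖ + ‖D1 * A₁ t * D1‖) + (‖D1 * A₂ t * P‖ + ‖P * A₃ t * P‖ + ‖P * A₂ t * D1‖)
        + (‖D1 * A₁ t * D1‖ + ‖P * A₂ t * D1‖ + ‖P * A₁ t * D2‖) := by
        gcongr <;> exact norm_add₃_le
    _ ≤ (‖D2‖ * ‖A₁ t‖ * ‖P‖ + ‖D1‖ * ‖A₂ t‖ * ‖P‖ + ‖D1‖ * ‖A₁ t‖ * ‖D1‖)
        + (‖D1‖ * ‖A₂ t‖ * ‖P‖ + ‖P‖ * ‖A₃ t‖ * ‖P‖ + ‖P‖ * ‖A₂ t‖ * ‖D1‖)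
        + (‖D1‖ * ‖A₁ t‖ * ‖D1‖ + ‖P‖ * ‖A₂ t‖ * ‖D1‖ + ‖P‖ * ‖A₁ t‖ * ‖D2‖) := by
        gcongr <;> exact norm_mul3_le _ _ _
    _ ≤ ((2 * p ^ 3 * a₁ ^ 2 + p ^ 2 * a₂) * a₁ * p + (p * a₁ * p) * a₂ * p + (p * a₁ * p) * a₁ * (p * a₁ * p))
        + ((p * a₁ * p) * a₂ * p + p * a₃ * p + p * a₂ * (p * a₁ * p))
        + ((p * a₁ * p) * a₁ * (p * a₁ * p) + p * a₂ * (p * a₁ * p) + p * a₁ * (2 * p ^ 3 * a₁ ^ 2 + p ^ 2 * a₂)) := by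
        gcongr
    _ = 6 * p ^ 4 * a₁ ^ 3 + 6 * p ^ 3 * a₁ * a₂ + p ^ 2 * a₃ := by ring

end Letters

/-! ## §3 Power counting on a punctured neighbourhood: degree `−2 − k` -/

section PowerCounting

variable {A₀ A₁ A₂ A₃ : ℝ → Matrix n n ℂ} {t : ℝ} {c₀ c₁ c₂ c₃ r R : ℝ}

/-- [our object] **Degree `−3`**: `‖A₀⁻¹‖ ≤ c₀/r²`, `‖A₁‖ ≤ c₁·r` ⟹ `‖invD1‖ ≤ c₀²c₁ / r³` (`r > 0`). -/
theorem norm_invD1_le_div_cube (hr : 0 < r) (hp : ‖(A₀ t)⁻¹‖ ≤ c₀ / r ^ 2) (h₁ : ‖A₁ t‖ ≤ c₁ * r) :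
    ‖invD1 A₀ A₁ t‖ ≤ c₀ ^ 2 * c₁ / r ^ 3 := by
  refine (norm_invD1_le hp h₁).trans (le_of_eq ?_)
  field_simp

/-- [our object] **Degree `−4`**: `‖A₀⁻¹‖ ≤ c₀/r²`, `‖A₁‖ ≤ c₁·r`, `‖A₂‖ ≤ c₂` ⟹ `‖invD2‖ ≤ (2c₀³c₁² + c₀²c₂) / r⁴` (`r > 0`). -/
theorem norm_invD2_le_div_pow_four (hr : 0 < r) (hp : ‖(A₀ t)⁻¹‖ ≤ c₀ / r ^ 2) (h₁ : ‖A₁ t‖ ≤ c₁ * r)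
    (h₂ : ‖A₂ t‖ ≤ c₂) :
    ‖invD2 A₀ A₁ A₂ t‖ ≤ (2 * c₀ ^ 3 * c₁ ^ 2 + c₀ ^ 2 * c₂) / r ^ 4 := by
  refine (norm_invD2_le hp h₁ h₂).trans (le_of_eq ?_)
  field_simp

/-- [our object] **Degree `−5` on a BOUNDED punctured neighbourhood**: `‖A₀⁻¹‖ ≤ c₀/r²`, `‖A₁‖ ≤ c₁·r`, `‖A₂‖ ≤ c₂`, `‖A₃‖ ≤ c₃`, `0 < r ≤ R`
⟹ `‖invD3‖ ≤ (6c₀⁴c₁³ + 6c₀³c₁c₂ + c₀²c₃R) / r⁵` (the `A₃` term `c₀²c₃/r⁴ ≤ c₀²c₃R/r⁵` is where `r ≤ R` enters). -/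
theorem norm_invD3_le_div_pow_five (hr : 0 < r) (hrR : r ≤ R) (hp : ‖(A₀ t)⁻¹‖ ≤ c₀ / r ^ 2)
    (h₁ : ‖A₁ t‖ ≤ c₁ * r) (h₂ : ‖A₂ t‖ ≤ c₂) (h₃ : ‖A₃ t‖ ≤ c₃) :
    ‖invD3 A₀ A₁ A₂ A₃ t‖ ≤ (6 * c₀ ^ 4 * c₁ ^ 3 + 6 * c₀ ^ 3 * c₁ * c₂ + c₀ ^ 2 * c₃ * R) / r ^ 5 := by
  have hc3 : 0 ≤ c₃ := (norm_nonneg _).trans h₃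
  refine (norm_invD3_le hp h₁ h₂ h₃).trans ?_
  have h1 : 6 * (c₀ / r ^ 2) ^ 4 * (c₁ * r) ^ 3 + 6 * (c₀ / r ^ 2) ^ 3 * (c₁ * r) * c₂
      = (6 * c₀ ^ 4 * c₁ ^ 3 + 6 * c₀ ^ 3 * c₁ * c₂) / r ^ 5 := by
    field_simp
  have h2 : (c₀ / r ^ 2) ^ 2 * c₃ ≤ c₀ ^ 2 * c₃ * R / r ^ 5 := by
    have e : (c₀ / r ^ 2) ^ 2 * c₃ = c₀ ^ 2 * c₃ * r / r ^ 5 := by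
      field_simp
    rw [e]
    exact div_le_div_of_nonneg_right (mul_le_mul_of_nonneg_left hrR (mul_nonneg (sq_nonneg _) hc3)) (by positivity)
  calc 6 * (c₀ / r ^ 2) ^ 4 * (c₁ * r) ^ 3 + 6 * (c₀ / r ^ 2) ^ 3 * (c₁ * r) * c₂ + (c₀ / r ^ 2) ^ 2 * c₃
      ≤ (6 * c₀ ^ 4 * c₁ ^ 3 + 6 * c₀ ^ 3 * c₁ * c₂) / r ^ 5 + c₀ ^ 2 * c₃ * R / r ^ 5 := by rw [← h1]; gcongr
    _ = (6 * c₀ ^ 4 * c₁ ^ 3 + 6 * c₀ ^ 3 * c₁ * c₂ + c₀ ^ 2 * c₃ * R) / r ^ 5 := by ring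

end PowerCounting

/-! ## §4 Entrywise exits of §3 (bridges `‖M i j‖ ≤ ‖M‖` = `GAN24/InverseRate.norm_entry_le` and `‖M‖ ≤ card·c` = `GAN24/InverseRate.norm_le_card_mul`, BY NAME) -/



section EntryExit

variable {A₀ A₁ A₂ A₃ : ℝ → Matrix n n ℂ} {t : ℝ} {c₀ c₁ c₂ c₃ r R : ℝ}

/-- [our object] entrywise degree `−3`: `‖(invD1 t) α β‖ ≤ c₀²c₁ / r³`. -/
theorem norm_invD1_entry_le_div_cube (hr : 0 < r) (hp : ‖(A₀ t)⁻¹‖ ≤ c₀ / r ^ 2) (h₁ : ‖A₁ t‖ ≤ c₁ * r) (α β : n) :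
    ‖invD1 A₀ A₁ t α β‖ ≤ c₀ ^ 2 * c₁ / r ^ 3 :=
  (norm_entry_le _ α β).trans (norm_invD1_le_div_cube hr hp h₁)

/-- [our object] entrywise degree `−4`: `‖(invD2 t) α β‖ ≤ (2c₀³c₁² + c₀²c₂) / r⁴`. -/
theorem norm_invD2_entry_le_div_pow_four (hr : 0 < r) (hp : ‖(A₀ t)⁻¹‖ ≤ c₀ / r ^ 2) (h₁ : ‖A₁ t‖ ≤ c₁ * r)
    (h₂ : ‖A₂ t‖ ≤ c₂) (α β : n) :
    ‖invD2 A₀ A₁ A₂ t α β‖ ≤ (2 * c₀ ^ 3 * c₁ ^ 2 + c₀ ^ 2 * c₂) / r ^ 4 :=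
  (norm_entry_le _ α β).trans (norm_invD2_le_div_pow_four hr hp h₁ h₂)

/-- [our object] entrywise degree `−5` (bounded zone `r ≤ R`): `‖(invD3 t) α β‖ ≤ (6c₀⁴c₁³ + 6c₀³c₁c₂ + c₀²c₃R) / r⁵`. -/
theorem norm_invD3_entry_le_div_pow_five (hr : 0 < r) (hrR : r ≤ R) (hp : ‖(A₀ t)⁻¹‖ ≤ c₀ / r ^ 2)
    (h₁ : ‖A₁ t‖ ≤ c₁ * r) (h₂ : ‖A₂ t‖ ≤ c₂) (h₃ : ‖A₃ t‖ ≤ c₃) (α β : n) :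
    ‖invD3 A₀ A₁ A₂ A₃ t α β‖ ≤ (6 * c₀ ^ 4 * c₁ ^ 3 + 6 * c₀ ^ 3 * c₁ * c₂ + c₀ ^ 2 * c₃ * R) / r ^ 5 :=
  (norm_entry_le _ α β).trans (norm_invD3_le_div_pow_five hr hrR hp h₁ h₂ h₃)

end EntryExit

/-! ## §5 Continuity of the chain members (the `hcont` data of an integration-by-parts chain) -/

section Continuity

variable {A₀ A₁ A₂ A₃ : ℝ → Matrix n n ℂ} {S : Set ℝ} {t : ℝ}

/-- [folklore] `s ↦ A₀(s)⁻¹` is continuous within `S` at a point of `S`-continuity of `A₀` where `det A₀(t)` is a unit. -/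
theorem continuousWithinAt_inv (h₀ : ContinuousWithinAt A₀ S t) (hdet : IsUnit (A₀ t).det) :
    ContinuousWithinAt (fun s => (A₀ s)⁻¹) S t := by
  have hinv : ContinuousAt Ring.inverse (A₀ t).det := by
    obtain ⟨u, hu⟩ := hdet
    rw [← hu]; exact NormedRing.inverse_continuousAt u
  exact (continuousAt_matrix_inv _ hinv).comp_continuousWithinAt h₀

/-- [folklore] continuity of the inverse on a set where `det A₀` is pointwise a unit. -/
theorem continuousOn_inv (h₀ : ContinuousOn A₀ S) (hdet : ∀ t ∈ S, IsUnit (A₀ t).det) :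
    ContinuousOn (fun s => (A₀ s)⁻¹) S := fun t ht => continuousWithinAt_inv (h₀ t ht) (hdet t ht)

/-- [our object] `invD1` is continuous on `S` when `A₀, A₁` are and `det A₀` is pointwise a unit there. -/
theorem continuousOn_invD1 (h₀ : ContinuousOn A₀ S) (h₁ : ContinuousOn A₁ S) (hdet : ∀ t ∈ S, IsUnit (A₀ t).det) :
    ContinuousOn (invD1 A₀ A₁) S := by
  have hP := continuousOn_inv h₀ hdet
  unfold invD1
  exact ((hP.mul h₁).mul hP).neg

/-- [our object] `invD2` is continuous on `S` when `A₀, A₁, A₂` are and `det A₀` is pointwise a unit there. -/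
theorem continuousOn_invD2 (h₀ : ContinuousOn A₀ S) (h₁ : ContinuousOn A₁ S) (h₂ : ContinuousOn A₂ S)
    (hdet : ∀ t ∈ S, IsUnit (A₀ t).det) : ContinuousOn (invD2 A₀ A₁ A₂) S := by
  have hP := continuousOn_inv h₀ hdet
  have hD1 := continuousOn_invD1 h₀ h₁ hdet
  unfold invD2
  exact ((((hD1.mul h₁).mul hP).add ((hP.mul h₂).mul hP)).add ((hP.mul h₁).mul hD1)).neg

/-- [our object] `invD3` is continuous on `S` when `A₀, …, A₃` are and `det A₀` is pointwise a unit there. -/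
theorem continuousOn_invD3 (h₀ : ContinuousOn A₀ S) (h₁ : ContinuousOn A₁ S) (h₂ : ContinuousOn A₂ S)
    (h₃ : ContinuousOn A₃ S) (hdet : ∀ t ∈ S, IsUnit (A₀ t).det) : ContinuousOn (invD3 A₀ A₁ A₂ A₃) S := by
  have hP := continuousOn_inv h₀ hdet
  have hD1 := continuousOn_invD1 h₀ h₁ hdet
  have hD2 := continuousOn_invD2 h₀ h₁ h₂ hdet
  unfold invD3
  exact (((((hD2.mul h₁).mul hP).add ((hD1.mul h₂).mul hP)).add ((hD1.mul h₁).mul hD1)).add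
    ((((hD1.mul h₂).mul hP).add ((hP.mul h₃).mul hP)).add ((hP.mul h₂).mul hD1))
    |>.add ((((hD1.mul h₁).mul hD1).add ((hP.mul h₂).mul hD1)).add ((hP.mul h₁).mul hD2))).neg

end Continuity

/-! ## §6 The entry-level chain (the literal `hder` shape of an integration-by-parts chain for matrix ENTRIES) -/

section EntryChain

variable {A₀ A₁ A₂ A₃ : ℝ → Matrix n n ℂ} {t : ℝ}

/-- [our object] entry level, order 1: `HasDerivAt (s ↦ A₀(s)⁻¹ α β) (invD1 A₀ A₁ t α β) t` (`MatrixInvDeriv.hasDerivAt_entry` BY NAME). -/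
theorem hasDerivAt_inv_apply (h₀ : HasDerivAt A₀ (A₁ t) t) (hdet : IsUnit (A₀ t).det) (α β : n) :
    HasDerivAt (fun s => (A₀ s)⁻¹ α β) (invD1 A₀ A₁ t α β) t :=
  hasDerivAt_entry (hasDerivAt_inv h₀ hdet) α β

/-- [our object] entry level, order 2: `HasDerivAt (s ↦ invD1 A₀ A₁ s α β) (invD2 A₀ A₁ A₂ t α β) t`. -/
theorem hasDerivAt_invD1_apply (h₀ : HasDerivAt A₀ (A₁ t) t) (h₁ : HasDerivAt A₁ (A₂ t) t) (hdet : IsUnit (A₀ t).det)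
    (α β : n) : HasDerivAt (fun s => invD1 A₀ A₁ s α β) (invD2 A₀ A₁ A₂ t α β) t :=
  hasDerivAt_entry (hasDerivAt_invD1 h₀ h₁ hdet) α β

/-- [our object] entry level, order 3: `HasDerivAt (s ↦ invD2 A₀ A₁ A₂ s α β) (invD3 A₀ A₁ A₂ A₃ t α β) t`. -/
theorem hasDerivAt_invD2_apply (h₀ : HasDerivAt A₀ (A₁ t) t) (h₁ : HasDerivAt A₁ (A₂ t) t) (h₂ : HasDerivAt A₂ (A₃ t) t)
    (hdet : IsUnit (A₀ t).det) (α β : n) :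
    HasDerivAt (fun s => invD2 A₀ A₁ A₂ s α β) (invD3 A₀ A₁ A₂ A₃ t α β) t :=
  hasDerivAt_entry (hasDerivAt_invD2 h₀ h₁ h₂ hdet) α β

end EntryChain

end Summit.QuantumFields.BalabanUV.Beta.FP.InverseSymbolDeriv
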